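import Literature.Probability.FitznerVanDerHofstad2017.Stage1TailsEval
import Literature.Probability.FitznerVanDerHofstad2017.Stage1EvalRec

/-!
# The `N ≥ 4` tails of cells 41–43 ON THE CELLS OF RECORD (`Stage1Cells.Rec`)

Literature layer, sorry-free, ADDITIVE companion of `Stage1Tails` / `Stage1TailsEval` (untouched) and of
`Stage1CellsRec` / `Stage1EvalRec`.  `Stage1Tails` types the `N ≥ 4` tails of notebook cells 41–43 over the typed
frame AS CODED; the certificate of record (`MeanFieldD11Cert`, cell `wborbx + wbg2 + hexprint`) evaluates the stage-1
formulas with the PRINTED weighted-bubble recipe of [NoBLE17-I] §5.3.3 (`Stage1Cells.Rec.wb3/wb4/wb5`, module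
`Stage1CellsRec`), which enters the tails through eight of their ingredients: `h^S` (in `h^S.AiotaNonRepᵀ`), `h^{II}`,
`C₁`, `C₂`, `C₁.B̄ + B.C₂`, `C₂.B̄ + B.C₁`, `H₃.P^E + AiotaNonRep.h^E`, `H₂.P^E + AiotaNonRep.h^E` (the cells
`Stage1Cells.Rec.hS/hII/C1/C2/C1BbarBC2/H2/H3/hE` of the closure listed in `Stage1CellsRec`); the matrices `B`, `B̄`
(cells 30–31), `P^S`, `P^ι`, `AiotabarNonRep`, `P^E` do not involve the weighted bubbles and are the coded cells.

This module is the tails layer RE-BOUND over those cells, definition by definition VERBATIM from `Stage1Tails`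
(section `Frame`) and `Stage1TailsEval` (section `Frame`) — same names inside the namespace `Stage1Tails.Rec`, whose
own `ingr`, `tailVal`, `inpT`, `inpFull`, `inpMaj`, `ingrQ`, `tailValQ`, `inpMajQ` shadow the coded ones — with
exactly these substitutions: the eight ingredient cells ↦ `Stage1Cells.Rec.*`; the tail-free record `Data.inp` ↦
`Data.inpRec` and its rational mirror `DataQ.inpR` ↦ `DataQ.inpRrec` (`Stage1EvalRec`); the cast lemma
`Data.inp_ratCast` ↦ `Data.inpRec_ratCast`.  The tail TABLES (`Tail.*`, one `Piece` per printed summand), the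
readings (`Reading.series`, `Reading.closed S S̄`), the Neumann-certificate lemmas and the rational mirror machinery
(`IngrQ`, `closedQ`, `totalQ`, `total_cast`, `cert_cast`) are `Stage1Tails`' / `Stage1TailsEval`'s own, imported.

Main content: `Rec.inpFull D y s` = cell 44 WITH TAILS on the cells of record; `Rec.inp_dom_inpFull`
(`D.inpRec ≤ Rec.inpFull`), `Rec.inpFull_dom_inpMaj` (≤ the closed-form majorant under the two exact-inverse Neumann
certificates), the rational majorant record `Rec.inpMajQ`, the cast lemma `Rec.inpMaj_ratCast` and the kernel form
`Rec.inpFull_dom_of_ratModel`.  No numeral, no table, no fact about a run is introduced here; the evaluation at the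
certified `d = 11` tables of the run of record is a separate module.  Proofs are the originals verbatim (they are
insensitive to which cells the ingredients are).  Generator and audit trail: programme cell `b2b/lace`, `lean2/g12`
(`work/gen_tails_rec.py`; rev 2: theorem names suffixed `_rec`, statements name the re-bound objects `Rec.·` explicitly —
they are NOT restatements of the `Stage1Tails` theorems of the same stem, which speak about the cells as coded).
-/

noncomputable section

namespace Literature.Probability.FitznerVanDerHofstad2017
namespace Stage1Tails.Rec

open Stage1Cells NoGoFrame BetaMap

/-! ## The tails over the typed frame, ingredients on the cells of record -/

section Frame

variable {ν : Type*}

/-- (cell of record: re-bound over `Stage1Cells.Rec`) `h^S.AiotaNonRepᵀ` (cell 42; cells 38–40 use `Aiota` here, cell 42 prints `AiotaNonRep`). [cite: FitznerVanDerHofstad2017, notebook Percolation.nb cell 42 (transcript l.1161–1164)] -/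
def hSAtNR (P : Params) : Vec := vecMul (Stage1Cells.Rec.hS P) (tr (AiotaNR P))

/-- (cell of record: re-bound over `Stage1Cells.Rec`) `H₃.P^E + AiotaNonRep.h^E` (cell 42). [cite: FitznerVanDerHofstad2017, notebook Percolation.nb cell 42 (transcript l.1161–1169)] -/
def H3PEAhE (P : Params) : Vec := vadd (Stage1Cells.mulVec (Stage1Cells.Rec.H3 P) (PE P)) (Stage1Cells.mulVec (AiotaNR P) (Stage1Cells.Rec.hE P))

/-- (cell of record: re-bound over `Stage1Cells.Rec`) `H₂.P^E + AiotaNonRep.h^E` (cell 42). [cite: FitznerVanDerHofstad2017, notebook Percolation.nb cell 42 (transcript l.1167–1170)] -/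
def H2PEAhE (P : Params) : Vec := vadd (Stage1Cells.mulVec (Stage1Cells.Rec.H2 P) (PE P)) (Stage1Cells.mulVec (AiotaNR P) (Stage1Cells.Rec.hE P))

/-- (cell of record: re-bound over `Stage1Cells.Rec`) `C₂.B̄ + B.C₁` (cell 42). [cite: FitznerVanDerHofstad2017, notebook Percolation.nb cell 42 (transcript l.1166–1169)] -/
def C2BbarBC1 (P : Params) : Mat := madd (matMul (Stage1Cells.Rec.C2 P) (Bbar P)) (matMul (B P) (Stage1Cells.Rec.C1 P))

/-- (cell of record: re-bound over `Stage1Cells.Rec`) The ingredients of cells 41–42 over the typed frame `D` at `(s, y)`. [cite: FitznerVanDerHofstad2017, notebook Percolation.nb cells 30–31, 41–42 (transcript l.840–888, l.1131–1175)] -/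
def ingr (D : Data ν) (s : Pt) (y : State) : Ingr (Fin 3) where
  u := fun
    | .PS => evV D s y (PS D.P)
    | .Piota => evV D s y (Piota D.P)
    | .hSAtNR => evV D s y (hSAtNR D.P)
    | .hII => evV D s y (Stage1Cells.Rec.hII D.P)
  m := fun
    | .AbarNR => evM D s y (AiotabarNR D.P)
    | .one => 1
    | .C1 => evM D s y (Stage1Cells.Rec.C1 D.P)
    | .C2 => evM D s y (Stage1Cells.Rec.C2 D.P)
    | .C1BbBC2 => evM D s y (Stage1Cells.Rec.C1BbarBC2 D.P)
    | .C2BbBC1 => evM D s y (C2BbarBC1 D.P)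
  w := fun
    | .PE => evV D s y (PE D.P)
    | .H3PEAhE => evV D s y (H3PEAhE D.P)
    | .H2PEAhE => evV D s y (H2PEAhE D.P)
  B := evM D s y (B D.P)
  Bb := evM D s y (Bbar D.P)

/-- (cell of record: re-bound over `Stage1Cells.Rec`) where every cell is `≥ 0` the ingredients are `≥ 0`. [folklore] -/
theorem ingr_nonneg_rec {D : Data ν} {s : Pt} {y : State} (hev : ∀ e, 0 ≤ D.ev s y e) : (Rec.ingr D s y).Nonneg where
  u t i := by cases t <;> exact hev _
  m t i j := by
    cases t
    case one => exact one_apply_nonneg i j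
    all_goals exact hev _
  w t i := by cases t <;> exact hev _
  B i j := hev _
  Bb i j := hev _

/-- (cell of record: re-bound over `Stage1Cells.Rec`) the value at `(s, y)` of a cell-41/42 table under the reading `Φ`. [folklore] -/
def tailVal (Φ : Reading (Fin 3)) (D : Data ν) (y : State) (s : Pt) (l : List Piece) : ℝ :=
  total Φ (ingr D s y) l

/-- (cell of record: re-bound over `Stage1Cells.Rec`, tail-free record `Data.inpRec`) Cell 44 with the `N ≥ 4` tails of cells 41–43 READ BY `Φ` added to the tail-free record `Data.inpRec` (`T″₀`):
`EvenTail = Bound[·,2,·] + tail`, `OddTail = Bound[·,3,·] + tail`, and cell 43's sums `Even = 0 + EvenTail`,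
`Odd = 1 + OddTail`, `Absolut = Odd + Even` accordingly (twenty-two fields move; the rest is `Data.inpRec`).
[cite: FitznerVanDerHofstad2017, notebook Percolation.nb cells 43–44 (transcript l.1182–1202, l.1214–1237)] -/
def inpT (Φ : Pt → Reading (Fin 3)) (D : Data ν) (y : State) (s : Pt) : Inputs :=
  { D.inpRec y s with
    xiAbs := (D.inpRec y s).xiAbs + (tailVal (Φ s) D y s Tail.xiOdd + tailVal (Φ s) D y s Tail.xiEven)
    xiOdd := (D.inpRec y s).xiOdd + tailVal (Φ s) D y s Tail.xiOdd
    xiEven := (D.inpRec y s).xiEven + tailVal (Φ s) D y s Tail.xiEven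
    xiEvenTail := (D.inpRec y s).xiEvenTail + tailVal (Φ s) D y s Tail.xiEven
    xiOddTail := (D.inpRec y s).xiOddTail + tailVal (Φ s) D y s Tail.xiOdd
    xiDeltaAbs := (D.inpRec y s).xiDeltaAbs
      + (tailVal (Φ s) D y s Tail.xiOddDelta + tailVal (Φ s) D y s Tail.xiEvenDelta)
    xiOddDelta := (D.inpRec y s).xiOddDelta + tailVal (Φ s) D y s Tail.xiOddDelta
    xiEvenDelta := (D.inpRec y s).xiEvenDelta + tailVal (Φ s) D y s Tail.xiEvenDelta
    xiOddTailDelta := (D.inpRec y s).xiOddTailDelta + tailVal (Φ s) D y s Tail.xiOddDelta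
    xiEvenTailDelta := (D.inpRec y s).xiEvenTailDelta + tailVal (Φ s) D y s Tail.xiEvenDelta
    xiIotaAbs := (D.inpRec y s).xiIotaAbs + (tailVal (Φ s) D y s Tail.xiIotaOdd + tailVal (Φ s) D y s Tail.xiIotaEven)
    xiIotaOdd := (D.inpRec y s).xiIotaOdd + tailVal (Φ s) D y s Tail.xiIotaOdd
    xiIotaEven := (D.inpRec y s).xiIotaEven + tailVal (Φ s) D y s Tail.xiIotaEven
    xiIotaEvenTail := (D.inpRec y s).xiIotaEvenTail + tailVal (Φ s) D y s Tail.xiIotaEven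
    xiIotaDeltaEi := (D.inpRec y s).xiIotaDeltaEi
      + (tailVal (Φ s) D y s Tail.xiIotaOddDeltaEi + tailVal (Φ s) D y s Tail.xiIotaEvenDeltaEi)
    xiIotaOddDeltaEi := (D.inpRec y s).xiIotaOddDeltaEi + tailVal (Φ s) D y s Tail.xiIotaOddDeltaEi
    xiIotaEvenDeltaEi := (D.inpRec y s).xiIotaEvenDeltaEi + tailVal (Φ s) D y s Tail.xiIotaEvenDeltaEi
    xiIotaEvenTailDeltaEi := (D.inpRec y s).xiIotaEvenTailDeltaEi + tailVal (Φ s) D y s Tail.xiIotaEvenDeltaEi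
    xiIotaDeltaZero := (D.inpRec y s).xiIotaDeltaZero
      + (tailVal (Φ s) D y s Tail.xiIotaOddDeltaZero + tailVal (Φ s) D y s Tail.xiIotaEvenDeltaZero)
    xiIotaOddDeltaZero := (D.inpRec y s).xiIotaOddDeltaZero + tailVal (Φ s) D y s Tail.xiIotaOddDeltaZero
    xiIotaEvenDeltaZero := (D.inpRec y s).xiIotaEvenDeltaZero + tailVal (Φ s) D y s Tail.xiIotaEvenDeltaZero
    xiIotaEvenTailDeltaZero := (D.inpRec y s).xiIotaEvenTailDeltaZero + tailVal (Φ s) D y s Tail.xiIotaEvenDeltaZero }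

/-- (cell of record: re-bound over `Stage1Cells.Rec`) CELL 44 AS THE NOTEBOOK ITERATES IT: the App. D input record WITH the `N ≥ 4` tails (series reading).
[cite: FitznerVanDerHofstad2017, notebook Percolation.nb cells 41–44 (transcript l.1131–1237)] -/
def inpFull (D : Data ν) (y : State) (s : Pt) : Inputs := inpT (fun _ => Reading.series) D y s

/-- (cell of record: re-bound over `Stage1Cells.Rec`) The closed-form MAJORANT record at candidate inverses `S s` of `1 − B(s)²` and `S̄ s` of `1 − B̄(s)²`.
[cite: FitznerVanDerHofstad2017, notebook Percolation.nb cells 41–44 (transcript l.1131–1237)] -/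
def inpMaj (S Sb : Pt → Matrix (Fin 3) (Fin 3) ℝ) (D : Data ν) (y : State) (s : Pt) : Inputs :=
  inpT (fun s => Reading.closed (S s) (Sb s)) D y s

variable {D : Data ν} {y : State} {s : Pt}

/-- (cell of record: re-bound over `Stage1Cells.Rec`) `Data.inpRec ≤ inpT Φ` for a non-negative reading. [folklore] -/
theorem inp_dom_inpT_rec {Φ : Pt → Reading (Fin 3)} (hΦ : (Φ s).NonnegAt (Rec.ingr D s y).B (Rec.ingr D s y).Bb)
    (hI : (Rec.ingr D s y).Nonneg) : (D.inpRec y s).Dom (Rec.inpT Φ D y s) where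
  mu := le_rfl
  muMin := le_rfl
  mubOverMu := le_rfl
  mub := le_rfl
  xiAlphaOneMinusZeroAtZero := le_rfl
  xiAlphaZeroMinusOneAtZero := le_rfl
  xiAlphaOneMinusZeroAtEi := le_rfl
  xiAlphaZeroMinusOneAtEi := le_rfl
  xiIotaAlphaIAtEi := le_rfl
  xiIotaAlphaIIAtZero := le_rfl
  xiIotaAlphaISumAroundEi := le_rfl
  xiIotaAlphaIISumAroundZero := le_rfl
  psiAlphaIOneMinusZeroAroundEi := le_rfl
  psiAlphaIIZeroMinusOneAroundZero := le_rfl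
  psiAlphaIZeroMinusOneAroundEi := le_rfl
  psiAlphaIIOneMinusZeroAroundZero := le_rfl
  piAlpha := le_rfl
  piAlphaLower := le_rfl
  piOneLower := le_rfl
  psiZeroLower := le_rfl
  xiAbs := le_add_of_nonneg_right (add_nonneg (total_nonneg hΦ hI _) (total_nonneg hΦ hI _))
  xiOdd := le_add_of_nonneg_right (total_nonneg hΦ hI _)
  xiEven := le_add_of_nonneg_right (total_nonneg hΦ hI _)
  xiEvenTail := le_add_of_nonneg_right (total_nonneg hΦ hI _)
  xiOddTail := le_add_of_nonneg_right (total_nonneg hΦ hI _)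
  xiR0 := le_rfl
  xiR1 := le_rfl
  xiR0Delta := le_rfl
  xiR1Delta := le_rfl
  xiDeltaAbs := le_add_of_nonneg_right (add_nonneg (total_nonneg hΦ hI _) (total_nonneg hΦ hI _))
  xiOddDelta := le_add_of_nonneg_right (total_nonneg hΦ hI _)
  xiEvenDelta := le_add_of_nonneg_right (total_nonneg hΦ hI _)
  xiOddTailDelta := le_add_of_nonneg_right (total_nonneg hΦ hI _)
  xiEvenTailDelta := le_add_of_nonneg_right (total_nonneg hΦ hI _)
  psiRI0 := le_rfl
  psiRI1 := le_rfl
  psiRII0 := le_rfl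
  psiRII1 := le_rfl
  psiRI0Delta := le_rfl
  psiRI1Delta := le_rfl
  psiRII0Delta := le_rfl
  psiRII1Delta := le_rfl
  piR0 := le_rfl
  piR0DeltaEiEk := le_rfl
  xiIotaAbs := le_add_of_nonneg_right (add_nonneg (total_nonneg hΦ hI _) (total_nonneg hΦ hI _))
  xiIotaOdd := le_add_of_nonneg_right (total_nonneg hΦ hI _)
  xiIotaEven := le_add_of_nonneg_right (total_nonneg hΦ hI _)
  xiIotaEvenTail := le_add_of_nonneg_right (total_nonneg hΦ hI _)
  xiIotaRI0 := le_rfl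
  xiIotaRII0 := le_rfl
  xiIotaDeltaEi := le_add_of_nonneg_right (add_nonneg (total_nonneg hΦ hI _) (total_nonneg hΦ hI _))
  xiIotaOddDeltaEi := le_add_of_nonneg_right (total_nonneg hΦ hI _)
  xiIotaEvenDeltaEi := le_add_of_nonneg_right (total_nonneg hΦ hI _)
  xiIotaEvenTailDeltaEi := le_add_of_nonneg_right (total_nonneg hΦ hI _)
  xiIotaDeltaZero := le_add_of_nonneg_right (add_nonneg (total_nonneg hΦ hI _) (total_nonneg hΦ hI _))
  xiIotaOddDeltaZero := le_add_of_nonneg_right (total_nonneg hΦ hI _)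
  xiIotaEvenDeltaZero := le_add_of_nonneg_right (total_nonneg hΦ hI _)
  xiIotaEvenTailDeltaZero := le_add_of_nonneg_right (total_nonneg hΦ hI _)
  xiIotaRI0DeltaEi := le_rfl
  xiIotaRII0DeltaZero := le_rfl

/-- (cell of record: re-bound over `Stage1Cells.Rec`) `inpT Φ ≤ inpT Ψ` for comparable readings. [folklore] -/
theorem inpT_dom_inpT_rec {Φ Ψ : Pt → Reading (Fin 3)} (h : (Φ s).LEAt (Ψ s) (Rec.ingr D s y).B (Rec.ingr D s y).Bb)
    (hI : (Rec.ingr D s y).Nonneg) : (Rec.inpT Φ D y s).Dom (Rec.inpT Ψ D y s) where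
  mu := le_rfl
  muMin := le_rfl
  mubOverMu := le_rfl
  mub := le_rfl
  xiAlphaOneMinusZeroAtZero := le_rfl
  xiAlphaZeroMinusOneAtZero := le_rfl
  xiAlphaOneMinusZeroAtEi := le_rfl
  xiAlphaZeroMinusOneAtEi := le_rfl
  xiIotaAlphaIAtEi := le_rfl
  xiIotaAlphaIIAtZero := le_rfl
  xiIotaAlphaISumAroundEi := le_rfl
  xiIotaAlphaIISumAroundZero := le_rfl
  psiAlphaIOneMinusZeroAroundEi := le_rfl
  psiAlphaIIZeroMinusOneAroundZero := le_rfl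
  psiAlphaIZeroMinusOneAroundEi := le_rfl
  psiAlphaIIOneMinusZeroAroundZero := le_rfl
  piAlpha := le_rfl
  piAlphaLower := le_rfl
  piOneLower := le_rfl
  psiZeroLower := le_rfl
  xiAbs := add_le_add le_rfl (add_le_add (total_mono h hI _) (total_mono h hI _))
  xiOdd := add_le_add le_rfl (total_mono h hI _)
  xiEven := add_le_add le_rfl (total_mono h hI _)
  xiEvenTail := add_le_add le_rfl (total_mono h hI _)
  xiOddTail := add_le_add le_rfl (total_mono h hI _)
  xiR0 := le_rfl
  xiR1 := le_rfl
  xiR0Delta := le_rfl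
  xiR1Delta := le_rfl
  xiDeltaAbs := add_le_add le_rfl (add_le_add (total_mono h hI _) (total_mono h hI _))
  xiOddDelta := add_le_add le_rfl (total_mono h hI _)
  xiEvenDelta := add_le_add le_rfl (total_mono h hI _)
  xiOddTailDelta := add_le_add le_rfl (total_mono h hI _)
  xiEvenTailDelta := add_le_add le_rfl (total_mono h hI _)
  psiRI0 := le_rfl
  psiRI1 := le_rfl
  psiRII0 := le_rfl
  psiRII1 := le_rfl
  psiRI0Delta := le_rfl
  psiRI1Delta := le_rfl
  psiRII0Delta := le_rfl
  psiRII1Delta := le_rfl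
  piR0 := le_rfl
  piR0DeltaEiEk := le_rfl
  xiIotaAbs := add_le_add le_rfl (add_le_add (total_mono h hI _) (total_mono h hI _))
  xiIotaOdd := add_le_add le_rfl (total_mono h hI _)
  xiIotaEven := add_le_add le_rfl (total_mono h hI _)
  xiIotaEvenTail := add_le_add le_rfl (total_mono h hI _)
  xiIotaRI0 := le_rfl
  xiIotaRII0 := le_rfl
  xiIotaDeltaEi := add_le_add le_rfl (add_le_add (total_mono h hI _) (total_mono h hI _))
  xiIotaOddDeltaEi := add_le_add le_rfl (total_mono h hI _)
  xiIotaEvenDeltaEi := add_le_add le_rfl (total_mono h hI _)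
  xiIotaEvenTailDeltaEi := add_le_add le_rfl (total_mono h hI _)
  xiIotaDeltaZero := add_le_add le_rfl (add_le_add (total_mono h hI _) (total_mono h hI _))
  xiIotaOddDeltaZero := add_le_add le_rfl (total_mono h hI _)
  xiIotaEvenDeltaZero := add_le_add le_rfl (total_mono h hI _)
  xiIotaEvenTailDeltaZero := add_le_add le_rfl (total_mono h hI _)
  xiIotaRI0DeltaEi := le_rfl
  xiIotaRII0DeltaZero := le_rfl

/-- (cell of record: re-bound over `Stage1Cells.Rec`) `T″₀ ≤ T`: the tail-free record is below the record with tails in the information order, wherever the cells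
are `≥ 0`. [folklore] -/
theorem inp_dom_inpFull_rec (hev : ∀ e, 0 ≤ D.ev s y e) : (D.inpRec y s).Dom (Rec.inpFull D y s) :=
  inp_dom_inpT_rec (Reading.series_nonnegAt _ _) (ingr_nonneg_rec hev)

/-- (cell of record: re-bound over `Stage1Cells.Rec`) `T ≤ T̂(S, S̄)`: under the two Neumann certificates at the point `s` the record with tails is below the
closed-form majorant record (and the ten tail series converge there, `ser_le`). [folklore] -/
theorem inpFull_dom_inpMaj_rec (hev : ∀ e, 0 ≤ D.ev s y e) {S Sb : Pt → Matrix (Fin 3) (Fin 3) ℝ}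
    (hS0 : ∀ i j, 0 ≤ S s i j) (hS : (1 - (Rec.ingr D s y).B * (Rec.ingr D s y).B) * S s = 1)
    (hSb0 : ∀ i j, 0 ≤ Sb s i j) (hSb : (1 - (Rec.ingr D s y).Bb * (Rec.ingr D s y).Bb) * Sb s = 1) :
    (Rec.inpFull D y s).Dom (Rec.inpMaj S Sb D y s) :=
  inpT_dom_inpT_rec
    (Reading.series_leAt_closed (ingr_nonneg_rec hev).B (ingr_nonneg_rec hev).Bb hS0 hS hSb0 hSb) (ingr_nonneg_rec hev)

/-- (cell of record: re-bound over `Stage1Cells.Rec`) … hence `T″₀ ≤ T̂(S, S̄)` as well. [folklore] -/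
theorem inp_dom_inpMaj_rec (hev : ∀ e, 0 ≤ D.ev s y e) {S Sb : Pt → Matrix (Fin 3) (Fin 3) ℝ}
    (hS0 : ∀ i j, 0 ≤ S s i j) (hS : (1 - (Rec.ingr D s y).B * (Rec.ingr D s y).B) * S s = 1)
    (hSb0 : ∀ i j, 0 ≤ Sb s i j) (hSb : (1 - (Rec.ingr D s y).Bb * (Rec.ingr D s y).Bb) * Sb s = 1) :
    (D.inpRec y s).Dom (Rec.inpMaj S Sb D y s) :=
  (inp_dom_inpFull_rec hev).trans (inpFull_dom_inpMaj_rec hev hS0 hS hSb0 hSb)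

end Frame

/-! ## The rational majorant record on the cells of record, and the cast lemmas over a modelled frame -/

section RatFrame

variable {ν : Type*}

/-- (cell of record: re-bound over `Stage1Cells.Rec`) the rational ingredients of cells 41–42 over the data `E` at `(s, y)` (mirror of `ingr`). [folklore] -/
def ingrQ (E : DataQ) (P : Params) (s : Pt) (y : StateQ) : IngrQ (Fin 3) where
  u := fun
    | .PS => evVQ E P s y (PS P)
    | .Piota => evVQ E P s y (Piota P)
    | .hSAtNR => evVQ E P s y (hSAtNR P)
    | .hII => evVQ E P s y (Stage1Cells.Rec.hII P)
  m := fun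
    | .AbarNR => evMQ E P s y (AiotabarNR P)
    | .one => 1
    | .C1 => evMQ E P s y (Stage1Cells.Rec.C1 P)
    | .C2 => evMQ E P s y (Stage1Cells.Rec.C2 P)
    | .C1BbBC2 => evMQ E P s y (Stage1Cells.Rec.C1BbarBC2 P)
    | .C2BbBC1 => evMQ E P s y (C2BbarBC1 P)
  w := fun
    | .PE => evVQ E P s y (PE P)
    | .H3PEAhE => evVQ E P s y (H3PEAhE P)
    | .H2PEAhE => evVQ E P s y (H2PEAhE P)
  B := evMQ E P s y (B P)
  Bb := evMQ E P s y (Bbar P)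

/-- (cell of record: re-bound over `Stage1Cells.Rec`) the rational value of a cell-41/42 table under the closed-form reading at `S`, `S̄`. [folklore] -/
def tailValQ (E : DataQ) (P : Params) (y : StateQ) (s : Pt) (S Sb : Matrix (Fin 3) (Fin 3) ℚ)
    (l : List Piece) : ℚ :=
  totalQ S Sb (ingrQ E P s y) l

/-- (cell of record: re-bound over `Stage1Cells.Rec`, tail-free record `DataQ.inpRrec`) THE RATIONAL MAJORANT RECORD: `Stage1Cells.DataQ.inpRrec` with the closed-form tails at `S s`, `S̄ s` added to the
twenty-two tail fields, literally as in `inpT`. [folklore] -/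
def inpMajQ (E : DataQ) (P : Params) (y : StateQ) (s : Pt) (S Sb : Pt → Matrix (Fin 3) (Fin 3) ℚ) : Inputs :=
  let tv : List Piece → ℝ := fun l => ((tailValQ E P y s (S s) (Sb s) l : ℚ) : ℝ)
  { E.inpRrec P y s with
    xiAbs := (E.inpRrec P y s).xiAbs + (tv Tail.xiOdd + tv Tail.xiEven)
    xiOdd := (E.inpRrec P y s).xiOdd + tv Tail.xiOdd
    xiEven := (E.inpRrec P y s).xiEven + tv Tail.xiEven
    xiEvenTail := (E.inpRrec P y s).xiEvenTail + tv Tail.xiEven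
    xiOddTail := (E.inpRrec P y s).xiOddTail + tv Tail.xiOdd
    xiDeltaAbs := (E.inpRrec P y s).xiDeltaAbs + (tv Tail.xiOddDelta + tv Tail.xiEvenDelta)
    xiOddDelta := (E.inpRrec P y s).xiOddDelta + tv Tail.xiOddDelta
    xiEvenDelta := (E.inpRrec P y s).xiEvenDelta + tv Tail.xiEvenDelta
    xiOddTailDelta := (E.inpRrec P y s).xiOddTailDelta + tv Tail.xiOddDelta
    xiEvenTailDelta := (E.inpRrec P y s).xiEvenTailDelta + tv Tail.xiEvenDelta
    xiIotaAbs := (E.inpRrec P y s).xiIotaAbs + (tv Tail.xiIotaOdd + tv Tail.xiIotaEven)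
    xiIotaOdd := (E.inpRrec P y s).xiIotaOdd + tv Tail.xiIotaOdd
    xiIotaEven := (E.inpRrec P y s).xiIotaEven + tv Tail.xiIotaEven
    xiIotaEvenTail := (E.inpRrec P y s).xiIotaEvenTail + tv Tail.xiIotaEven
    xiIotaDeltaEi := (E.inpRrec P y s).xiIotaDeltaEi + (tv Tail.xiIotaOddDeltaEi + tv Tail.xiIotaEvenDeltaEi)
    xiIotaOddDeltaEi := (E.inpRrec P y s).xiIotaOddDeltaEi + tv Tail.xiIotaOddDeltaEi
    xiIotaEvenDeltaEi := (E.inpRrec P y s).xiIotaEvenDeltaEi + tv Tail.xiIotaEvenDeltaEi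
    xiIotaEvenTailDeltaEi := (E.inpRrec P y s).xiIotaEvenTailDeltaEi + tv Tail.xiIotaEvenDeltaEi
    xiIotaDeltaZero := (E.inpRrec P y s).xiIotaDeltaZero
      + (tv Tail.xiIotaOddDeltaZero + tv Tail.xiIotaEvenDeltaZero)
    xiIotaOddDeltaZero := (E.inpRrec P y s).xiIotaOddDeltaZero + tv Tail.xiIotaOddDeltaZero
    xiIotaEvenDeltaZero := (E.inpRrec P y s).xiIotaEvenDeltaZero + tv Tail.xiIotaEvenDeltaZero
    xiIotaEvenTailDeltaZero := (E.inpRrec P y s).xiIotaEvenTailDeltaZero + tv Tail.xiIotaEvenDeltaZero }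

variable {D : Data ν} {E : DataQ} (h : D.RatModel E)
include h

/-- (cell of record: re-bound over `Stage1Cells.Rec`) the ingredients of a modelled frame are the casts of the rational ones. [folklore] -/
theorem ingr_ratCast_rec (s : Pt) (y : StateQ) : Rec.ingr D s y.cast = (Rec.ingrQ E D.P s y).cast := by
  have hv : ∀ v : Vec, evV D s y.cast v = (Rat.castHom ℝ) ∘ evVQ E D.P s y v :=
    fun v => funext fun a => Data.ev_ratCast h s y (v a)
  have hm : ∀ Mx : Mat, evM D s y.cast Mx = (evMQ E D.P s y Mx).map (Rat.castHom ℝ) :=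
    fun Mx => Matrix.ext fun a b => Data.ev_ratCast h s y (Mx a b)
  have h1 : (1 : Matrix (Fin 3) (Fin 3) ℝ) = (1 : Matrix (Fin 3) (Fin 3) ℚ).map (Rat.castHom ℝ) :=
    (Matrix.map_one _ (map_zero _) (map_one _)).symm
  show Ingr.mk _ _ _ _ _ = Ingr.mk _ _ _ _ _
  congr 1
  · funext t; cases t <;> exact hv _
  · funext t; cases t <;> first | exact hm _ | exact h1
  · funext t; cases t <;> exact hv _
  · exact hm _
  · exact hm _

/-- (cell of record: re-bound over `Stage1Cells.Rec`) the tail value of a modelled frame under the cast closed-form reading is the cast of the rational one. [folklore] -/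
theorem tailVal_ratCast_rec (y : StateQ) (s : Pt) (S Sb : Matrix (Fin 3) (Fin 3) ℚ) (l : List Piece) :
    Rec.tailVal (Reading.closed (S.map (Rat.castHom ℝ)) (Sb.map (Rat.castHom ℝ))) D y.cast s l
      = ((Rec.tailValQ E D.P y s S Sb l : ℚ) : ℝ) := by
  unfold tailVal tailValQ; rw [ingr_ratCast_rec h]; exact total_cast S Sb _ l

/-- (cell of record: re-bound over `Stage1Cells.Rec`) THE CAST LEMMA FOR THE MAJORANT RECORD. [folklore] -/
theorem inpMaj_ratCast_rec (y : StateQ) (s : Pt) (S Sb : Pt → Matrix (Fin 3) (Fin 3) ℚ) :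
    Rec.inpMaj (fun t => (S t).map (Rat.castHom ℝ)) (fun t => (Sb t).map (Rat.castHom ℝ)) D y.cast s
      = Rec.inpMajQ E D.P y s S Sb := by
  simp only [inpMaj, inpT, inpMajQ, tailVal_ratCast_rec h, Data.inpRec_ratCast h]

/-- (cell of record: re-bound over `Stage1Cells.Rec`) kernel form: the majorant record of a modelled frame is dominated by `N` if the rational one is. [folklore] -/
theorem inpMaj_dom_of_ratModel_rec {y : StateQ} {s : Pt} {S Sb : Pt → Matrix (Fin 3) (Fin 3) ℚ} {N : Inputs}
    (hN : (Rec.inpMajQ E D.P y s S Sb).Dom N) :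
    (Rec.inpMaj (fun t => (S t).map (Rat.castHom ℝ)) (fun t => (Sb t).map (Rat.castHom ℝ)) D y.cast s).Dom N := by
  rw [inpMaj_ratCast_rec h]; exact hN

/-- (cell of record: re-bound over `Stage1Cells.Rec`) THE FULL CHAIN IN KERNEL FORM: the cell-44 record WITH ITS TAILS (series reading) of a modelled frame is dominated
by a record `N` as soon as the cells are `≥ 0` at the state, the two RATIONAL Neumann certificates hold at the point,
and the rational majorant record is dominated by `N` — the last three being closed rational facts. [folklore] -/
theorem inpFull_dom_of_ratModel_rec {y : StateQ} {s : Pt} {S Sb : Pt → Matrix (Fin 3) (Fin 3) ℚ} {N : Inputs}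
    (hev : ∀ e, 0 ≤ D.ev s y.cast e)
    (hS0 : ∀ i j, 0 ≤ S s i j) (hS : (1 - (Rec.ingrQ E D.P s y).B * (Rec.ingrQ E D.P s y).B) * S s = 1)
    (hSb0 : ∀ i j, 0 ≤ Sb s i j) (hSb : (1 - (Rec.ingrQ E D.P s y).Bb * (Rec.ingrQ E D.P s y).Bb) * Sb s = 1)
    (hN : (Rec.inpMajQ E D.P y s S Sb).Dom N) : (Rec.inpFull D y.cast s).Dom N := by
  have hB : (ingr D s y.cast).B = (ingrQ E D.P s y).B.map (Rat.castHom ℝ) := by rw [ingr_ratCast_rec h]; rfl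
  have hBb : (ingr D s y.cast).Bb = (ingrQ E D.P s y).Bb.map (Rat.castHom ℝ) := by rw [ingr_ratCast_rec h]; rfl
  refine (inpFull_dom_inpMaj_rec hev (S := fun t => (S t).map (Rat.castHom ℝ))
    (Sb := fun t => (Sb t).map (Rat.castHom ℝ)) (nonneg_cast hS0) ?_ (nonneg_cast hSb0) ?_).trans
    (inpMaj_dom_of_ratModel_rec h hN)
  · show (1 - _ * _) * (S s).map (Rat.castHom ℝ) = 1
    rw [hB]; exact cert_cast hS
  · show (1 - _ * _) * (Sb s).map (Rat.castHom ℝ) = 1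
    rw [hBb]; exact cert_cast hSb

/-- (cell of record: re-bound over `Stage1Cells.Rec`) … and so is the tail-free record `Data.inpRec` (which `Stage1Eval` also gives directly). [folklore] -/
theorem inp_dom_of_ratModel_tails_rec {y : StateQ} {s : Pt} {S Sb : Pt → Matrix (Fin 3) (Fin 3) ℚ} {N : Inputs}
    (hev : ∀ e, 0 ≤ D.ev s y.cast e)
    (hS0 : ∀ i j, 0 ≤ S s i j) (hS : (1 - (Rec.ingrQ E D.P s y).B * (Rec.ingrQ E D.P s y).B) * S s = 1)
    (hSb0 : ∀ i j, 0 ≤ Sb s i j) (hSb : (1 - (Rec.ingrQ E D.P s y).Bb * (Rec.ingrQ E D.P s y).Bb) * Sb s = 1)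
    (hN : (Rec.inpMajQ E D.P y s S Sb).Dom N) : (D.inpRec y.cast s).Dom N :=
  (inp_dom_inpFull_rec hev).trans (inpFull_dom_of_ratModel_rec h hev hS0 hS hSb0 hSb hN)

end RatFrame

end Stage1Tails.Rec
end Literature.Probability.FitznerVanDerHofstad2017
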